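import Literature.MathematicalPhysics.QuantumFieldTheory.Balaban1983to89.B9Eq325ProjFormula
import Literature.MathematicalPhysics.QuantumFieldTheory.Balaban1983to89.B9Eq3126GreenLetters

/-!
# `Balaban1983to89.B9Eq326WoodburySchur` — T. Bałaban, *Propagators for lattice gauge theories in a background field*, Commun. Math. Phys. **99**
# (1985) 389–434 [Balaban1985BackgroundPropagators] (3.25)–(3.26) pp. 394–395 with Thm 3.11 p. 416: **THE GAUGE-FIXED OPERATOR `Δ_a = Δ + DRD* + aQ*Q`
# AROUND ITS LOCAL PART — since `R = I − P`, `P = G′Q′*(Q′G′²Q′*)⁻¹Q′G′` (3.25), one has `Δ_a = A₀ − C*cC` with `A₀ := Δ + DD* + aQ*Q`,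
# `C := Q′G′D*`, `c := (Q′G′²Q′*)⁻¹`; the WOODBURY identity `Δ_a⁻¹ = A₀⁻¹ + A₀⁻¹C*·S⁻¹·CA₀⁻¹` with the SCHUR complement `S = c⁻¹ − CA₀⁻¹C*`
# (a COARSE-lattice operator), and the converse formula `S⁻¹ = c + cC·Δ_a⁻¹·C*c`** — typed as [folklore] algebra of linear maps between two modules
# (`E` = fine bond fields, `F` = coarse site fields), every inverse a DISPLAYED two-sided letter; the algebraic skeleton of the NE9 owner's plan v11
# «storey G₁ by Woodbury around A₀» (`t4/b2b-balaban-t4-ne9-p1/g91/PLAN-V11-STOREY-G1.md`)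

statement-level skeleton of published theorems with citation tags; proofs where landed; nothing here is a claim about the Yang–Mills mass gap

CITATION HEADER (lean-in-tree rule).  Audit cell `pub-balaban`, sub-cell `t4`, BINDER row NE9; filed by the NE9 BINDER-row OWNER lineage
`b2b-balaban-t4-ne9-p1` (gen 91).  §1–§3 use Mathlib only; §4 imports `B9Eq325ProjFormula` (ne9-leaf-06 g63: (3.25) for the chain's `R(U)`) and through it
`B9Eq326OperatorAssembly` (this lineage g77: `laplaceAofU`, `G1ofU`); §6 (v1.4) imports `B9Eq3126GreenLetters` (ne9 chain: `norm_greenK_le`).  Sources READ first-hand (`paper:balaban1985-cmp99-background-propagators`, journal page = PDF page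
+ 388): p. 394 (3.25) *«Rf = (I − G′Q′*(Q′G′²Q′*)⁻¹Q′G′)f»*, p. 395 (3.26) *«Δ_a(U) = Δ(U) + D_U R(U) D*_U + Q*(U)aQ(U)»*, p. 416 Thm 3.11 (positivity of
`Δ′_a, G′, (Q′G′²Q′*)⁻¹, Δ_a, G`), p. 416 *«G = G₀(I − R)⁻¹»* (print's own perturbation of the gauge-fixing term is the random walk of Sect. C, NOT this).
PRINT's OWN SPLIT: [Balaban1985Variational] (134) p. 298 *«(Δ + DRD*)A = (D*D + DD*)A + (Δ′ − DPD*)A»* with (135) the lattice Weitzenböck identity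
and p. 299 *«DPD* is a bounded operator»* — in the tree as lit-balaban's `B11Eq135Weitzenbock.eq134` ∕ `eq135η` ∕ `norm_curvOp_le` (on its own carriers);
this file adds the INVERSION of that split.  The identity itself is the Sherman–Morrison–Woodbury formula of linear algebra (Mathlib has the matrix case
`Matrix.add_mul_mul_inv_eq_sub`); here it is needed for linear maps between two DIFFERENT modules with one-sided letters, hence re-derived (four `ext`
computations).

WHY (cell context).  The tree's words for `𝔓`, `𝔊`, `H₁` ([B9] (3.147)∕(3.153), `B9Eq3153LocalLetterWords`, ne9-leaf-03 g72) pass (3.42)-letters from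
four primitive rows: `G′(U)` (storey (D), this lineage), `(Q′G′²Q′*)⁻¹` (road B8″), and `G₁(U) = Δ_a(U)⁻¹`, `(QG₁Q*)⁻¹` — OPEN.  The cell's energy∕positivity
route reaches `A₀⁻¹` (covariant bond Laplacian of Kato form + the O(α₀) curvature∕Weitzenböck letters of (3.10) on print's class (3.35) + the block-local
penalty) but not the second-order, coarse-rank term `−DPD*`.  This file is the exact algebra that moves that term to the COARSE lattice: after it the sup
row of `G₁` needs the rows of `A₀⁻¹`, `A₀⁻¹D`, `D*A₀⁻¹`, `G′`, `Q′`, and the decay of ONE gapped coarse-lattice inverse `S⁻¹` — no new fine-lattice analysis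
of `Δ_a` itself.

WHAT IS PROVED (sorry-free; proof lane — no `def`, no `Prop` placeholder; [folklore] algebra, every inverse a displayed letter).
* §1 `woodbury_right_inv`, `woodbury_left_inv`: for `A, Ai : E → E` (`A∘Ai = id`, resp. `Ai∘A = id`), `Uu : F → E`, `V : E → F`, `c, ci : F → F`
  (`c∘ci = id`, resp. `ci∘c = id`), `si` with `(ci − V∘Ai∘Uu)∘si = id` (resp. `si∘(ci − V∘Ai∘Uu) = id`):
  `(A − Uu∘c∘V) ∘ (Ai + Ai∘Uu∘si∘V∘Ai) = id` (resp. the left version) — **`Δ_a⁻¹ = A₀⁻¹ + A₀⁻¹C*S⁻¹CA₀⁻¹`**.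
* §2 `schur_right_inv`, `schur_left_inv`: conversely, from a two-sided inverse `Gi` of `A − Uu∘c∘V` (print's `G₁`, Thm 3.11) the Schur complement
  `ci − V∘Ai∘Uu` HAS the inverse `c + c∘V∘Gi∘Uu∘c` — **`S⁻¹ = c + cC·G₁·C*c`** (existence and, in a normed setting, `‖S⁻¹‖ ≤ ‖c‖ + ‖c‖²‖C‖²‖G₁‖`); hence
  §1 applies with `si := c + c∘V∘Gi∘Uu∘c` and **`woodbury_of_inverse`**: `Gi = Ai + Ai∘Uu∘(c + c∘V∘Gi∘Uu∘c)∘V∘Ai` — the form in which the decay of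
  `G₁` is read off the decay of its coarse-lattice core.
* §3 `norm_schurInv_le` (normed spaces, continuous linear maps): the operator-norm bound of `c + c∘V∘Gi∘Uu∘c`.
* §4 THE INSTANCE AT THE CHAIN's (3.26), letters `A₀ = Δ(U) + D_UD*_U + Q†(a·Q)`, `Uu = D_UG′(U)Q′(U)†`, `V = Q′(U)G′(U)D*_U` displayed by their
  defining equations: **`laplaceAofU_eq_local_sub`** — `Δ_a(U) = A₀ − Uu∘(Q′G′²Q′†)⁻¹∘V` as linear maps (`laplaceAofU_eq` + `RofU_eq_formula`, mutually
  adjoint transporters `hRS`, positivity `hpos′` of `Δ′_{a′}(U)` displayed); **`G1ofU_eq_woodbury`** — under the DISPLAYED positivity `hpos₀` of `A₀`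
  (`A₀⁻¹ := greenK A₀ hpos₀`): `G₁(U) = A₀⁻¹ + A₀⁻¹∘Uu∘(c + c∘V∘G₁(U)∘Uu∘c)∘V∘A₀⁻¹`, `c = (Q′G′²Q′†)⁻¹` — print's `G₁(U)` BY NAME as its local part plus the
  coarse sandwich.
* §5 THE POSITIVITY OF THE LOCAL PART IS FREE: **`re_inner_correction_nonneg`** (`re⟪x, Uu(c(Vx))⟫ = re⟪Vx, c(Vx)⟫ ≥ 0` — `D*_U = D_U†` for mutually
  adjoint transporters, `G′` symmetric, `c` the inverse of a positive operator) and **`local_pos_of_pos`** (`Δ_a(U) > 0 ⟹ A₀ > 0`: the `hpos₀` of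
  `G1ofU_eq_woodbury` DISCHARGED from Thm 3.11's `hpos` — `A₀ = Δ_a + Uu∘c∘V ≥ Δ_a`).
* §6 (v1.4, gen 92) THE LOCAL PART INHERITS THE COERCIVITY CONSTANT: **`local_coercive_of_coercive`** (`γ‖x‖² ≤ re⟪x, Δ_a(U)x⟫ ⟹ γ‖x‖² ≤
  re⟪x, A₀x⟫`) and **`norm_localInv_le`** (`‖A₀⁻¹g‖ ≤ γ⁻¹‖g‖` — `B9Eq3126GreenLetters.norm_greenK_le`): the energy letter (E₀) of the `A₀⁻¹` rows in Thm
  3.11's displayed currency `γ`, no new analysis.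
HONEST SCOPE.  Linear algebra + one unfolding + one positivity bookkeeping; nothing of Thm 3.1∕3.3∕3.11 asserted (the positivity of `Δ_a(U)` stays the
displayed `hpos`, as everywhere in the chain); «NE9 ⇐ the named binders»; NE9 NOT PRINTED ∕ NOT PROVED; row WALLED ON A MODEL (O-NE9-1; NEEDS-COORDINATOR
#5 UNRULED); spine PROVED 0∕9; rung (B)+1 on a finite T⁴ — NOT infinite volume, NOT mass gap, NOT BetaPertH, NOT Clay.  HONEST DEPENDENCY: continuum YM on T⁴ ⇐
BetaPertH ∧ nine spine estimates (0/9 proved); BetaPertH ⇐ (D1) ∧ (D4) ∧ CAP+tail; G-an2-4 gates asym, D1 and NE2/3/4.  NEW file.  Net new unproved facts: 0.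
-/

namespace Literature.MathematicalPhysics.QuantumFieldTheory.Balaban1983to89.B9Eq326WoodburySchur

/-! ## §1 Woodbury: the inverse of `A − Uu∘c∘V` from the inverses of `A`, `c` and of the Schur complement `ci − V∘Ai∘Uu` -/

section Algebra

variable {R : Type*} [Ring R] {E F : Type*} [AddCommGroup E] [Module R E] [AddCommGroup F] [Module R F]

/-- **WOODBURY, RIGHT INVERSE**: `A∘Ai = id`, `c∘ci = id`, `(ci − V∘Ai∘Uu)∘si = id` ⟹ `(A − Uu∘c∘V)∘(Ai + Ai∘Uu∘si∘V∘Ai) = id` — for (3.26) read as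
`Δ_a = A₀ − C*cC`: `Δ_a∘(A₀⁻¹ + A₀⁻¹C*S⁻¹CA₀⁻¹) = id`. [folklore] [cite: Balaban1985BackgroundPropagators, (3.25)–(3.26) pp.394–395] -/
theorem woodbury_right_inv (A Ai : E →ₗ[R] E) (hA : A ∘ₗ Ai = LinearMap.id) (Uu : F →ₗ[R] E) (V : E →ₗ[R] F) (c ci : F →ₗ[R] F)
    (hc : c ∘ₗ ci = LinearMap.id) (si : F →ₗ[R] F) (hs : (ci - V ∘ₗ Ai ∘ₗ Uu) ∘ₗ si = LinearMap.id) :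
    (A - Uu ∘ₗ c ∘ₗ V) ∘ₗ (Ai + Ai ∘ₗ Uu ∘ₗ si ∘ₗ V ∘ₗ Ai) = LinearMap.id := by
  have hA' : ∀ z, A (Ai z) = z := fun z => by simpa using LinearMap.congr_fun hA z
  have hc' : ∀ y, c (ci y) = y := fun y => by simpa using LinearMap.congr_fun hc y
  have hs' : ∀ y, ci (si y) - V (Ai (Uu (si y))) = y := fun y => by simpa using LinearMap.congr_fun hs y
  ext x
  simp only [LinearMap.comp_apply, LinearMap.sub_apply, LinearMap.add_apply, LinearMap.id_apply, map_add, hA']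
  have key : V (Ai (Uu (si (V (Ai x))))) = ci (si (V (Ai x))) - V (Ai x) := by
    have h := hs' (V (Ai x))
    rw [sub_eq_iff_eq_add] at h
    rw [h]; abel
  rw [key, map_sub, map_sub, hc']
  abel

/-- **WOODBURY, LEFT INVERSE**: `Ai∘A = id`, `ci∘c = id`, `si∘(ci − V∘Ai∘Uu) = id` ⟹ `(Ai + Ai∘Uu∘si∘V∘Ai)∘(A − Uu∘c∘V) = id`.
[folklore] [cite: Balaban1985BackgroundPropagators, (3.25)–(3.26) pp.394–395] -/
theorem woodbury_left_inv (A Ai : E →ₗ[R] E) (hA : Ai ∘ₗ A = LinearMap.id) (Uu : F →ₗ[R] E) (V : E →ₗ[R] F) (c ci : F →ₗ[R] F)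
    (hc : ci ∘ₗ c = LinearMap.id) (si : F →ₗ[R] F) (hs : si ∘ₗ (ci - V ∘ₗ Ai ∘ₗ Uu) = LinearMap.id) :
    (Ai + Ai ∘ₗ Uu ∘ₗ si ∘ₗ V ∘ₗ Ai) ∘ₗ (A - Uu ∘ₗ c ∘ₗ V) = LinearMap.id := by
  have hA' : ∀ z, Ai (A z) = z := fun z => by simpa using LinearMap.congr_fun hA z
  have hc' : ∀ y, ci (c y) = y := fun y => by simpa using LinearMap.congr_fun hc y
  have hs' : ∀ y, si (ci y - V (Ai (Uu y))) = y := fun y => by simpa using LinearMap.congr_fun hs y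
  ext x
  simp only [LinearMap.comp_apply, LinearMap.sub_apply, LinearMap.add_apply, LinearMap.id_apply, map_sub, hA']
  -- `si(V(Ai(Uu(c(Vx))))) = si(ci(c(Vx))) − c(Vx) = …` via the Schur letter at `y := c (V x)`
  have key : si (V (Ai (Uu (c (V x))))) = si (V x) - c (V x) := by
    have h := hs' (c (V x))
    rw [hc', map_sub] at h
    rw [sub_eq_iff_eq_add'] at h
    rw [eq_sub_iff_add_eq, ← h]
  rw [key, map_sub, map_sub]
  abel

/-! ## §2 The converse: the Schur complement inverted from an inverse of `A − Uu∘c∘V` (print's `G₁`, Thm 3.11) -/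

/-- **`S⁻¹ = c + cC·G₁·C*c`, RIGHT**: `Ai∘A = id`, `c∘ci = id`… precisely: `ci∘c = id`, `(A − Uu∘c∘V)∘Gi = id` ⟹ `(ci − V∘Ai∘Uu)∘(c + c∘V∘Gi∘Uu∘c) = id`.
[folklore] [cite: Balaban1985BackgroundPropagators, (3.25)–(3.26) pp.394–395, Thm 3.11 p.416] -/
theorem schur_right_inv (A Ai : E →ₗ[R] E) (hA : Ai ∘ₗ A = LinearMap.id) (Uu : F →ₗ[R] E) (V : E →ₗ[R] F) (c ci : F →ₗ[R] F)
    (hc : ci ∘ₗ c = LinearMap.id) (Gi : E →ₗ[R] E) (hG : (A - Uu ∘ₗ c ∘ₗ V) ∘ₗ Gi = LinearMap.id) :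
    (ci - V ∘ₗ Ai ∘ₗ Uu) ∘ₗ (c + c ∘ₗ V ∘ₗ Gi ∘ₗ Uu ∘ₗ c) = LinearMap.id := by
  have hA' : ∀ z, Ai (A z) = z := fun z => by simpa using LinearMap.congr_fun hA z
  have hc' : ∀ y, ci (c y) = y := fun y => by simpa using LinearMap.congr_fun hc y
  have hG' : ∀ z, A (Gi z) - Uu (c (V (Gi z))) = z := fun z => by simpa using LinearMap.congr_fun hG z
  ext y
  simp only [LinearMap.comp_apply, LinearMap.sub_apply, LinearMap.add_apply, LinearMap.id_apply, map_add, hc']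
  -- `V(Ai(Uu(c(V(Gi w))))) = V(Ai(A(Gi w))) − V(Ai w) = V(Gi w) − V(Ai w)` at `w := Uu (c y)`
  have key : V (Ai (Uu (c (V (Gi (Uu (c y))))))) = V (Gi (Uu (c y))) - V (Ai (Uu (c y))) := by
    have h := hG' (Uu (c y))
    rw [sub_eq_iff_eq_add] at h
    have h2 : Uu (c (V (Gi (Uu (c y))))) = A (Gi (Uu (c y))) - Uu (c y) := by rw [h]; abel
    rw [h2, map_sub, map_sub, hA']
  rw [key]
  abel

/-- **`S⁻¹ = c + cC·G₁·C*c`, LEFT**: `A∘Ai = id`, `c∘ci = id`, `Gi∘(A − Uu∘c∘V) = id` ⟹ `(c + c∘V∘Gi∘Uu∘c)∘(ci − V∘Ai∘Uu) = id`.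
[folklore] [cite: Balaban1985BackgroundPropagators, (3.25)–(3.26) pp.394–395, Thm 3.11 p.416] -/
theorem schur_left_inv (A Ai : E →ₗ[R] E) (hA : A ∘ₗ Ai = LinearMap.id) (Uu : F →ₗ[R] E) (V : E →ₗ[R] F) (c ci : F →ₗ[R] F)
    (hc : c ∘ₗ ci = LinearMap.id) (Gi : E →ₗ[R] E) (hG : Gi ∘ₗ (A - Uu ∘ₗ c ∘ₗ V) = LinearMap.id) :
    (c + c ∘ₗ V ∘ₗ Gi ∘ₗ Uu ∘ₗ c) ∘ₗ (ci - V ∘ₗ Ai ∘ₗ Uu) = LinearMap.id := by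
  have hA' : ∀ z, A (Ai z) = z := fun z => by simpa using LinearMap.congr_fun hA z
  have hc' : ∀ y, c (ci y) = y := fun y => by simpa using LinearMap.congr_fun hc y
  have hG' : ∀ z, Gi (A z - Uu (c (V z))) = z := fun z => by simpa using LinearMap.congr_fun hG z
  ext y
  simp only [LinearMap.comp_apply, LinearMap.sub_apply, LinearMap.add_apply, LinearMap.id_apply, map_sub, hc']
  -- `Gi(Uu(c(V(Ai(Uu y))))) = Gi(A(Ai(Uu y))) − Ai(Uu y) = Gi(Uu y) − Ai(Uu y)` by the inverse letter at `z := Ai (Uu y)`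
  have key : Gi (Uu (c (V (Ai (Uu y))))) = Gi (Uu y) - Ai (Uu y) := by
    have h := hG' (Ai (Uu y))
    rw [hA', map_sub] at h
    rw [sub_eq_iff_eq_add'] at h
    rw [eq_sub_iff_add_eq, ← h]
  rw [key, map_sub, map_sub]
  abel

/-- **WOODBURY FROM AN INVERSE OF `A − Uu∘c∘V`** (the form used for DECAY): if `A`, `c` are two-sidedly inverted by `Ai`, `ci` and `Gi` is a two-sided
inverse of `A − Uu∘c∘V`, then `Gi = Ai + Ai∘Uu∘(c + c∘V∘Gi∘Uu∘c)∘V∘Ai` — print's `G₁` is its local part `A₀⁻¹` plus a sandwich of the coarse core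
`S⁻¹ = c + cC·G₁·C*c`. [folklore] [cite: Balaban1985BackgroundPropagators, (3.25)–(3.26) pp.394–395, Thm 3.11 p.416] -/
theorem woodbury_of_inverse (A Ai : E →ₗ[R] E) (hA : A ∘ₗ Ai = LinearMap.id) (hA' : Ai ∘ₗ A = LinearMap.id) (Uu : F →ₗ[R] E) (V : E →ₗ[R] F)
    (c ci : F →ₗ[R] F) (hc : c ∘ₗ ci = LinearMap.id) (hc' : ci ∘ₗ c = LinearMap.id) (Gi : E →ₗ[R] E)
    (hG : (A - Uu ∘ₗ c ∘ₗ V) ∘ₗ Gi = LinearMap.id) (hG' : Gi ∘ₗ (A - Uu ∘ₗ c ∘ₗ V) = LinearMap.id) :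
    Gi = Ai + Ai ∘ₗ Uu ∘ₗ (c + c ∘ₗ V ∘ₗ Gi ∘ₗ Uu ∘ₗ c) ∘ₗ V ∘ₗ Ai := by
  set si : F →ₗ[R] F := c + c ∘ₗ V ∘ₗ Gi ∘ₗ Uu ∘ₗ c
  have hs : (ci - V ∘ₗ Ai ∘ₗ Uu) ∘ₗ si = LinearMap.id := schur_right_inv A Ai hA' Uu V c ci hc' Gi hG
  -- both `Gi` and the Woodbury expression are right inverses of `A − Uu∘c∘V`; `Gi` is also a left inverse, so they agree
  have hW : (A - Uu ∘ₗ c ∘ₗ V) ∘ₗ (Ai + Ai ∘ₗ Uu ∘ₗ si ∘ₗ V ∘ₗ Ai) = LinearMap.id := woodbury_right_inv A Ai hA Uu V c ci hc si hs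
  calc Gi = Gi ∘ₗ ((A - Uu ∘ₗ c ∘ₗ V) ∘ₗ (Ai + Ai ∘ₗ Uu ∘ₗ si ∘ₗ V ∘ₗ Ai)) := by rw [hW, LinearMap.comp_id]
    _ = (Gi ∘ₗ (A - Uu ∘ₗ c ∘ₗ V)) ∘ₗ (Ai + Ai ∘ₗ Uu ∘ₗ si ∘ₗ V ∘ₗ Ai) := by rw [LinearMap.comp_assoc]
    _ = Ai + Ai ∘ₗ Uu ∘ₗ si ∘ₗ V ∘ₗ Ai := by rw [hG', LinearMap.id_comp]

end Algebra

/-! ## §3 The operator norm of the coarse core `S⁻¹ = c + cC·G₁·C*c` -/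

section Norm

variable {𝕜 : Type*} [NontriviallyNormedField 𝕜] {E F : Type*} [NormedAddCommGroup E] [NormedSpace 𝕜 E] [NormedAddCommGroup F] [NormedSpace 𝕜 F]

/-- **`‖S⁻¹‖ ≤ ‖c‖ + ‖c‖·‖V‖·‖G₁‖·‖Uu‖·‖c‖`** for `S⁻¹ = c + c∘V∘G₁∘Uu∘c` (continuous linear maps): the GAP letter of the coarse core from the `L²`
bounds of `c = (Q′G′²Q′*)⁻¹`, `C = Q′G′D*` and `G₁` (Thm 3.11) — the input of a Combes–Thomas decay argument on the unit lattice.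
[folklore] [cite: Balaban1985BackgroundPropagators, Thm 3.11 p.416, (3.25)–(3.26) pp.394–395] -/
theorem norm_schurInv_le (c : F →L[𝕜] F) (V : E →L[𝕜] F) (Gi : E →L[𝕜] E) (Uu : F →L[𝕜] E) :
    ‖c + c ∘L V ∘L Gi ∘L Uu ∘L c‖ ≤ ‖c‖ + ‖c‖ * ‖V‖ * ‖Gi‖ * ‖Uu‖ * ‖c‖ := by
  refine (norm_add_le _ _).trans (add_le_add le_rfl ?_)
  calc ‖c ∘L V ∘L Gi ∘L Uu ∘L c‖ ≤ ‖c‖ * ‖V ∘L Gi ∘L Uu ∘L c‖ := ContinuousLinearMap.opNorm_comp_le _ _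
    _ ≤ ‖c‖ * (‖V‖ * (‖Gi‖ * (‖Uu‖ * ‖c‖))) := by
        gcongr
        exact (ContinuousLinearMap.opNorm_comp_le _ _).trans (mul_le_mul_of_nonneg_left
          ((ContinuousLinearMap.opNorm_comp_le _ _).trans (mul_le_mul_of_nonneg_left (ContinuousLinearMap.opNorm_comp_le _ _) (norm_nonneg _)))
          (norm_nonneg _))
    _ = ‖c‖ * ‖V‖ * ‖Gi‖ * ‖Uu‖ * ‖c‖ := by ring

end Norm

/-! ## §4 The instance: the chain's `Δ_a(U)` (3.26) around its local part, and `G₁(U)` in Woodbury form -/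

section Instance

open scoped InnerProductSpace ComplexConjugate
open B4Sect5Torus (TSite)
open B9SectCLatticeCarrier (Bond)
open B9Eq311L2Pairing (WL2)
open B9Eq319QprimeTorus (fineP)
open B11Eq103H1Complex (SiteL2K BondL2K greenK apply_greenK greenK_apply comp_greenK greenK_comp covDerivL2K covDivL2K laplaceALatticeK laplaceAK_apply)
open B9Eq310HessianOperator (adTransportW hessOp)
open B9Eq3119DeltaPiCarrier (laplacePrimeA GpOfU)
open B9Eq326OperatorAssembly (QprimeW RofU laplaceAofU laplaceAofU_eq G1ofU)
open B9Eq325ProjFormula (QGGQ_pos RofU_eq_formula)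

variable {d : ℕ} (L : ℕ) [NeZero L] (m : Fin d → ℕ) {𝔸 : Type*} [Ring 𝔸] [StarRing 𝔸] [Algebra ℂ 𝔸] [StarModule ℂ 𝔸]
  {W : Type*} [NormedAddCommGroup W] [InnerProductSpace ℂ W] [FiniteDimensional ℂ W] (φ : W ≃ₗ[ℂ] 𝔸) (c₀ : ℝ) [Fact (0 < c₀)]
  (η : ℝ) (U : Bond d (fineP L m) → 𝔸ˣ) (c₁ : ℝ) [Fact (0 < c₁)] (a' : ℝ)
  (hRS : ∀ (b : Bond d (fineP L m)) (v u : W), ⟪adTransportW φ U b v, u⟫_ℂ = ⟪v, adTransportW φ (fun b => (U b)⁻¹) b u⟫_ℂ)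
  (hpos' : ∀ x : SiteL2K ℂ d (fineP L m) c₀ W, x ≠ 0 → 0 < RCLike.re ⟪x, laplacePrimeA L m φ η U a' (c₁ := c₁) x⟫_ℂ)
  (τ : 𝔸 →ₗ[ℂ] ℂ) {F : Type*} [NormedAddCommGroup F] [InnerProductSpace ℂ F] [FiniteDimensional ℂ F]
  (Q : BondL2K ℂ d (fineP L m) c₀ W →ₗ[ℂ] F) (a : ℝ)

include hRS in
/-- **(3.26) AROUND ITS LOCAL PART**, letters displayed: with `G′ = G′(U)` ((3.25), positivity `hpos′`), `Q̃′ = Q′(U)` read into the weight-`c₁` coarse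
carrier, `c = (Q̃′G′²Q̃′†)⁻¹`, `D = D_U`, `D* = D*_U` ((3.3)∕(3.8) at `η⁻¹`) and the LETTERS `A₀ = Δ(U) + DD* + Q†(a·Q)` (the local part), `Uu = DG′Q̃′†`,
`V = Q̃′G′D*`: `Δ_a(U) = A₀ − Uu∘c∘V` as linear maps — (3.25) `R = I − G′Q̃′†cQ̃′G′` (`B9Eq325ProjFormula.RofU_eq_formula`, mutually adjoint transporters
`hRS`) inserted in `DRD*`. [cite: Balaban1985BackgroundPropagators, (3.25)–(3.26) pp.394–395] -/
theorem laplaceAofU_eq_local_sub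
    (A₀ : BondL2K ℂ d (fineP L m) c₀ W →ₗ[ℂ] BondL2K ℂ d (fineP L m) c₀ W)
    (hA₀ : A₀ = hessOp φ η U τ + covDerivL2K ℂ c₀ ((η : ℂ))⁻¹ (adTransportW φ U) ∘ₗ covDivL2K ℂ c₀ ((η : ℂ))⁻¹ (adTransportW φ fun b => (U b)⁻¹) +
      LinearMap.adjoint Q ∘ₗ ((a : ℂ) • Q))
    (Uu : SiteL2K ℂ d m c₁ W →ₗ[ℂ] BondL2K ℂ d (fineP L m) c₀ W)
    (hUu : Uu = covDerivL2K ℂ c₀ ((η : ℂ))⁻¹ (adTransportW φ U) ∘ₗ GpOfU L m φ η U a' (c₁ := c₁) hpos' ∘ₗ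
      LinearMap.adjoint ((WL2.linearEquiv ℂ ℂ (fun _ : TSite d m => c₁)).symm.toLinearMap ∘ₗ QprimeW L m φ U (c₀ := c₀)))
    (V : BondL2K ℂ d (fineP L m) c₀ W →ₗ[ℂ] SiteL2K ℂ d m c₁ W)
    (hV : V = ((WL2.linearEquiv ℂ ℂ (fun _ : TSite d m => c₁)).symm.toLinearMap ∘ₗ QprimeW L m φ U (c₀ := c₀)) ∘ₗ
      GpOfU L m φ η U a' (c₁ := c₁) hpos' ∘ₗ covDivL2K ℂ c₀ ((η : ℂ))⁻¹ (adTransportW φ fun b => (U b)⁻¹)) :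
    laplaceAofU L m φ η U τ Q a = A₀ - Uu ∘ₗ greenK _ (QGGQ_pos L m φ c₀ η U c₁ a' hRS hpos') ∘ₗ V := by
  subst hA₀ hUu hV
  apply LinearMap.ext
  intro x
  rw [laplaceAofU_eq]
  simp only [laplaceALatticeK, laplaceAK_apply, LinearMap.sub_apply, LinearMap.add_apply, LinearMap.comp_apply, LinearMap.smul_apply,
    RofU_eq_formula L m φ c₀ η U c₁ a' hRS hpos', map_sub]
  abel

include hRS in
/-- **PRINT's `G₁(U)` IN WOODBURY FORM** (positivity `hpos` of `Δ_a(U)` = Thm 3.11 displayed; positivity `hpos₀` of the LOCAL part `A₀` displayed,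
`A₀⁻¹ := greenK A₀ hpos₀`; letters `A₀`, `Uu`, `V` as in `laplaceAofU_eq_local_sub`, `c = (Q̃′G′²Q̃′†)⁻¹`):
`G₁(U) = A₀⁻¹ + A₀⁻¹∘Uu∘(c + c∘V∘G₁(U)∘Uu∘c)∘V∘A₀⁻¹` — `woodbury_of_inverse`; the bracket is the coarse core `S⁻¹`, whose gap is §3 and whose decay on the
unit lattice is the one analytic input this re-routing asks for. [cite: Balaban1985BackgroundPropagators, (3.25)–(3.26) pp.394–395, Thm 3.11 p.416] -/
theorem G1ofU_eq_woodbury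
    (A₀ : BondL2K ℂ d (fineP L m) c₀ W →ₗ[ℂ] BondL2K ℂ d (fineP L m) c₀ W)
    (hA₀ : A₀ = hessOp φ η U τ + covDerivL2K ℂ c₀ ((η : ℂ))⁻¹ (adTransportW φ U) ∘ₗ covDivL2K ℂ c₀ ((η : ℂ))⁻¹ (adTransportW φ fun b => (U b)⁻¹) +
      LinearMap.adjoint Q ∘ₗ ((a : ℂ) • Q))
    (Uu : SiteL2K ℂ d m c₁ W →ₗ[ℂ] BondL2K ℂ d (fineP L m) c₀ W)
    (hUu : Uu = covDerivL2K ℂ c₀ ((η : ℂ))⁻¹ (adTransportW φ U) ∘ₗ GpOfU L m φ η U a' (c₁ := c₁) hpos' ∘ₗ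
      LinearMap.adjoint ((WL2.linearEquiv ℂ ℂ (fun _ : TSite d m => c₁)).symm.toLinearMap ∘ₗ QprimeW L m φ U (c₀ := c₀)))
    (V : BondL2K ℂ d (fineP L m) c₀ W →ₗ[ℂ] SiteL2K ℂ d m c₁ W)
    (hV : V = ((WL2.linearEquiv ℂ ℂ (fun _ : TSite d m => c₁)).symm.toLinearMap ∘ₗ QprimeW L m φ U (c₀ := c₀)) ∘ₗ
      GpOfU L m φ η U a' (c₁ := c₁) hpos' ∘ₗ covDivL2K ℂ c₀ ((η : ℂ))⁻¹ (adTransportW φ fun b => (U b)⁻¹))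
    (hpos : ∀ x : BondL2K ℂ d (fineP L m) c₀ W, x ≠ 0 → 0 < RCLike.re ⟪x, laplaceAofU L m φ η U τ Q a x⟫_ℂ)
    (hpos₀ : ∀ x : BondL2K ℂ d (fineP L m) c₀ W, x ≠ 0 → 0 < RCLike.re ⟪x, A₀ x⟫_ℂ) :
    G1ofU L m φ η U τ hpos =
      greenK A₀ hpos₀ + greenK A₀ hpos₀ ∘ₗ Uu ∘ₗ
        (greenK _ (QGGQ_pos L m φ c₀ η U c₁ a' hRS hpos') +
          greenK _ (QGGQ_pos L m φ c₀ η U c₁ a' hRS hpos') ∘ₗ V ∘ₗ G1ofU L m φ η U τ hpos ∘ₗ Uu ∘ₗ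
            greenK _ (QGGQ_pos L m φ c₀ η U c₁ a' hRS hpos')) ∘ₗ V ∘ₗ greenK A₀ hpos₀ := by
  have hsub := laplaceAofU_eq_local_sub L m φ c₀ η U c₁ a' hRS hpos' τ Q a A₀ hA₀ Uu hUu V hV
  -- `G₁(U)` is a two-sided inverse of `Δ_a(U) = A₀ − Uu∘c∘V`
  have hG : (laplaceAofU L m φ η U τ Q a) ∘ₗ G1ofU L m φ η U τ hpos = LinearMap.id := comp_greenK hpos
  have hG' : G1ofU L m φ η U τ hpos ∘ₗ (laplaceAofU L m φ η U τ Q a) = LinearMap.id := greenK_comp hpos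
  rw [hsub] at hG hG'
  exact woodbury_of_inverse A₀ _ (comp_greenK hpos₀) (greenK_comp hpos₀) Uu V (greenK _ (QGGQ_pos L m φ c₀ η U c₁ a' hRS hpos')) _
    (greenK_comp (QGGQ_pos L m φ c₀ η U c₁ a' hRS hpos')) (comp_greenK (QGGQ_pos L m φ c₀ η U c₁ a' hRS hpos')) _ hG hG'

end Instance

/-! ## §5 The positivity of the local part is FREE: `A₀ = Δ_a + Uu∘c∘V` with `re⟪x, Uu(c(Vx))⟫ = re⟪Vx, c(Vx)⟫ ≥ 0` -/

section LocalPos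

open scoped InnerProductSpace ComplexConjugate
open B4Sect5Torus (TSite)
open B9SectCLatticeCarrier (Bond)
open B9Eq311L2Pairing (WL2)
open B9Eq319QprimeTorus (fineP)
open B11Eq103H1Complex (SiteL2K BondL2K greenK apply_greenK re_inner_greenK_pos covDerivL2K covDivL2K adjoint_covDerivL2K)
open B9Eq310HessianOperator (adTransportW hessOp)
open B9Eq3119DeltaPiCarrier (laplacePrimeA GpOfU)
open B9Eq326OperatorAssembly (QprimeW laplaceAofU G1ofU)
open B9Eq325ProjFormula (QGGQ_pos laplacePrimeA_isSymmetric)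

variable {d : ℕ} (L : ℕ) [NeZero L] (m : Fin d → ℕ) {𝔸 : Type*} [Ring 𝔸] [StarRing 𝔸] [Algebra ℂ 𝔸] [StarModule ℂ 𝔸]
  {W : Type*} [NormedAddCommGroup W] [InnerProductSpace ℂ W] [FiniteDimensional ℂ W] (φ : W ≃ₗ[ℂ] 𝔸) (c₀ : ℝ) [Fact (0 < c₀)]
  (η : ℝ) (U : Bond d (fineP L m) → 𝔸ˣ) (c₁ : ℝ) [Fact (0 < c₁)] (a' : ℝ)
  (hRS : ∀ (b : Bond d (fineP L m)) (v u : W), ⟪adTransportW φ U b v, u⟫_ℂ = ⟪v, adTransportW φ (fun b => (U b)⁻¹) b u⟫_ℂ)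
  (hpos' : ∀ x : SiteL2K ℂ d (fineP L m) c₀ W, x ≠ 0 → 0 < RCLike.re ⟪x, laplacePrimeA L m φ η U a' (c₁ := c₁) x⟫_ℂ)
  (τ : 𝔸 →ₗ[ℂ] ℂ) {F : Type*} [NormedAddCommGroup F] [InnerProductSpace ℂ F] [FiniteDimensional ℂ F]
  (Q : BondL2K ℂ d (fineP L m) c₀ W →ₗ[ℂ] F) (a : ℝ)

omit [StarRing 𝔸] [StarModule ℂ 𝔸] in
include hRS in
/-- **THE GAUGE-FIXING CORRECTION IS NONNEGATIVE**: with `Uu = D_UG′Q̃′†`, `V = Q̃′G′D*_U`, `c = (Q̃′G′²Q̃′†)⁻¹` (mutually adjoint transporters `hRS`, so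
`D*_U = D_U†` and `G′` is symmetric): `re⟪x, Uu(c(Vx))⟫ = re⟪Vx, c(Vx)⟫ ≥ 0` — `c` is the inverse of a positive operator. Hence `A₀ = Δ_a + Uu∘c∘V ≥ Δ_a`
in the form sense: the LOCAL part inherits Thm 3.11's positivity. [cite: Balaban1985BackgroundPropagators, (3.25)–(3.26) pp.394–395, Thm 3.11 p.416] -/
theorem re_inner_correction_nonneg
    (Uu : SiteL2K ℂ d m c₁ W →ₗ[ℂ] BondL2K ℂ d (fineP L m) c₀ W)
    (hUu : Uu = covDerivL2K ℂ c₀ ((η : ℂ))⁻¹ (adTransportW φ U) ∘ₗ GpOfU L m φ η U a' (c₁ := c₁) hpos' ∘ₗ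
      LinearMap.adjoint ((WL2.linearEquiv ℂ ℂ (fun _ : TSite d m => c₁)).symm.toLinearMap ∘ₗ QprimeW L m φ U (c₀ := c₀)))
    (V : BondL2K ℂ d (fineP L m) c₀ W →ₗ[ℂ] SiteL2K ℂ d m c₁ W)
    (hV : V = ((WL2.linearEquiv ℂ ℂ (fun _ : TSite d m => c₁)).symm.toLinearMap ∘ₗ QprimeW L m φ U (c₀ := c₀)) ∘ₗ
      GpOfU L m φ η U a' (c₁ := c₁) hpos' ∘ₗ covDivL2K ℂ c₀ ((η : ℂ))⁻¹ (adTransportW φ fun b => (U b)⁻¹))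
    (x : BondL2K ℂ d (fineP L m) c₀ W) :
    0 ≤ RCLike.re ⟪x, Uu (greenK _ (QGGQ_pos L m φ c₀ η U c₁ a' hRS hpos') (V x))⟫_ℂ := by
  subst hUu hV
  -- `D† = D*` for mutually adjoint transporters and a real difference quotient
  have hconj : (starRingEnd ℂ) ((η : ℂ))⁻¹ = ((η : ℂ))⁻¹ := by rw [map_inv₀, Complex.conj_ofReal]
  have hadj : LinearMap.adjoint (covDerivL2K ℂ c₀ ((η : ℂ))⁻¹ (adTransportW φ U)) =
      covDivL2K ℂ c₀ ((η : ℂ))⁻¹ (adTransportW φ fun b => (U b)⁻¹) := adjoint_covDerivL2K ((η : ℂ))⁻¹ hconj _ _ hRS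
  -- `G′` symmetric: `⟪G′a, b⟫ = ⟪a, G′b⟫`
  have hGa : ∀ z, laplacePrimeA L m φ η U a' (c₁ := c₁) (GpOfU L m φ η U a' (c₁ := c₁) hpos' z) = z := fun z => apply_greenK hpos' z
  have hGsym : ∀ a b : SiteL2K ℂ d (fineP L m) c₀ W,
      ⟪GpOfU L m φ η U a' (c₁ := c₁) hpos' a, b⟫_ℂ = ⟪a, GpOfU L m φ η U a' (c₁ := c₁) hpos' b⟫_ℂ := fun a b => by
    have h1 := laplacePrimeA_isSymmetric L m φ c₀ η U c₁ a' hRS (GpOfU L m φ η U a' (c₁ := c₁) hpos' a)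
      (GpOfU L m φ η U a' (c₁ := c₁) hpos' b)
    rw [hGa, hGa] at h1
    exact h1.symm
  simp only [LinearMap.comp_apply]
  rw [← LinearMap.adjoint_inner_left, hadj, ← hGsym, LinearMap.adjoint_inner_right]
  set V' := ((WL2.linearEquiv ℂ ℂ (fun _ : TSite d m => c₁)).symm.toLinearMap ∘ₗ QprimeW L m φ U (c₀ := c₀))
    (GpOfU L m φ η U a' (c₁ := c₁) hpos' (covDivL2K ℂ c₀ ((η : ℂ))⁻¹ (adTransportW φ fun b => (U b)⁻¹) x))
  by_cases hV0 : V' = 0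
  · simp [hV0]
  · exact (re_inner_greenK_pos (QGGQ_pos L m φ c₀ η U c₁ a' hRS hpos') V' hV0).le

include hRS hpos' in
/-- **THE LOCAL PART IS POSITIVE WHENEVER `Δ_a(U)` IS** (Thm 3.11): with `A₀ = hessOp + D∘D* + Q†∘(a•Q)` and the letters `Uu`, `V` of §4,
`re⟪x, A₀x⟫ = re⟪x, Δ_a x⟫ + re⟪x, Uu(c(Vx))⟫ ≥ re⟪x, Δ_a x⟫ > 0` for `x ≠ 0` — the `hpos₀` of `G1ofU_eq_woodbury` DISCHARGED from `hpos`.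
[cite: Balaban1985BackgroundPropagators, (3.26) p.395, Thm 3.11 p.416] -/
theorem local_pos_of_pos
    (A₀ : BondL2K ℂ d (fineP L m) c₀ W →ₗ[ℂ] BondL2K ℂ d (fineP L m) c₀ W)
    (hA₀ : A₀ = hessOp φ η U τ + covDerivL2K ℂ c₀ ((η : ℂ))⁻¹ (adTransportW φ U) ∘ₗ covDivL2K ℂ c₀ ((η : ℂ))⁻¹ (adTransportW φ fun b => (U b)⁻¹) +
      LinearMap.adjoint Q ∘ₗ ((a : ℂ) • Q))
    (hpos : ∀ x : BondL2K ℂ d (fineP L m) c₀ W, x ≠ 0 → 0 < RCLike.re ⟪x, laplaceAofU L m φ η U τ Q a x⟫_ℂ)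
    (x : BondL2K ℂ d (fineP L m) c₀ W) (hx : x ≠ 0) : 0 < RCLike.re ⟪x, A₀ x⟫_ℂ := by
  have hsub := laplaceAofU_eq_local_sub L m φ c₀ η U c₁ a' hRS hpos' τ Q a A₀ hA₀ _ rfl _ rfl
  have hA : A₀ = laplaceAofU L m φ η U τ Q a +
      (covDerivL2K ℂ c₀ ((η : ℂ))⁻¹ (adTransportW φ U) ∘ₗ GpOfU L m φ η U a' (c₁ := c₁) hpos' ∘ₗ
        LinearMap.adjoint ((WL2.linearEquiv ℂ ℂ (fun _ : TSite d m => c₁)).symm.toLinearMap ∘ₗ QprimeW L m φ U (c₀ := c₀))) ∘ₗ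
      greenK _ (QGGQ_pos L m φ c₀ η U c₁ a' hRS hpos') ∘ₗ
      (((WL2.linearEquiv ℂ ℂ (fun _ : TSite d m => c₁)).symm.toLinearMap ∘ₗ QprimeW L m φ U (c₀ := c₀)) ∘ₗ
        GpOfU L m φ η U a' (c₁ := c₁) hpos' ∘ₗ covDivL2K ℂ c₀ ((η : ℂ))⁻¹ (adTransportW φ fun b => (U b)⁻¹)) := by
    rw [hsub]; abel
  have hcorr := re_inner_correction_nonneg L m φ c₀ η U c₁ a' hRS hpos' _ rfl _ rfl x
  rw [hA, LinearMap.add_apply, inner_add_right, map_add]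
  simp only [LinearMap.comp_apply] at hcorr ⊢
  linarith [hpos x hx]

end LocalPos

/-! ## §6 (v1.4) The local part inherits Thm 3.11's coercivity constant: `‖A₀⁻¹‖ ≤ γ⁻¹` -/
section LocalEnergy

open scoped InnerProductSpace ComplexConjugate
open B4Sect5Torus (TSite)
open B9SectCLatticeCarrier (Bond)
open B9Eq311L2Pairing (WL2)
open B9Eq319QprimeTorus (fineP)
open B11Eq103H1Complex (SiteL2K BondL2K greenK covDerivL2K covDivL2K)
open B9Eq310HessianOperator (adTransportW hessOp)
open B9Eq3119DeltaPiCarrier (laplacePrimeA GpOfU)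
open B9Eq326OperatorAssembly (QprimeW laplaceAofU)
open B9Eq325ProjFormula (QGGQ_pos)
open B9Eq3126GreenLetters (norm_greenK_le)
variable {d : ℕ} (L : ℕ) [NeZero L] (m : Fin d → ℕ) {𝔸 : Type*} [Ring 𝔸] [StarRing 𝔸] [Algebra ℂ 𝔸] [StarModule ℂ 𝔸]
  {W : Type*} [NormedAddCommGroup W] [InnerProductSpace ℂ W] [FiniteDimensional ℂ W] (φ : W ≃ₗ[ℂ] 𝔸) (c₀ : ℝ) [Fact (0 < c₀)]
  (η : ℝ) (U : Bond d (fineP L m) → 𝔸ˣ) (c₁ : ℝ) [Fact (0 < c₁)] (a' : ℝ)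
  (hRS : ∀ (b : Bond d (fineP L m)) (v u : W), ⟪adTransportW φ U b v, u⟫_ℂ = ⟪v, adTransportW φ (fun b => (U b)⁻¹) b u⟫_ℂ)
  (hpos' : ∀ x : SiteL2K ℂ d (fineP L m) c₀ W, x ≠ 0 → 0 < RCLike.re ⟪x, laplacePrimeA L m φ η U a' (c₁ := c₁) x⟫_ℂ)
  (τ : 𝔸 →ₗ[ℂ] ℂ) {F : Type*} [NormedAddCommGroup F] [InnerProductSpace ℂ F] [FiniteDimensional ℂ F]
  (Q : BondL2K ℂ d (fineP L m) c₀ W →ₗ[ℂ] F) (a : ℝ)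
include hRS hpos' in
/-- **THE LOCAL PART IS `γ`-COERCIVE WHENEVER `Δ_a(U)` IS** (Thm 3.11's quantitative positivity `hcoer`): `re⟪x, A₀x⟫ = re⟪x, Δ_a x⟫ + re⟪x, Uu(c(Vx))⟫
≥ γ‖x‖²` (`re_inner_correction_nonneg`). [cite: Balaban1985BackgroundPropagators, (3.26) p.395, Thm 3.11 p.416] -/
theorem local_coercive_of_coercive
    (A₀ : BondL2K ℂ d (fineP L m) c₀ W →ₗ[ℂ] BondL2K ℂ d (fineP L m) c₀ W)
    (hA₀ : A₀ = hessOp φ η U τ + covDerivL2K ℂ c₀ ((η : ℂ))⁻¹ (adTransportW φ U) ∘ₗ covDivL2K ℂ c₀ ((η : ℂ))⁻¹ (adTransportW φ fun b => (U b)⁻¹) +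
      LinearMap.adjoint Q ∘ₗ ((a : ℂ) • Q))
    {γ : ℝ} (hcoer : ∀ x : BondL2K ℂ d (fineP L m) c₀ W, γ * ‖x‖ ^ 2 ≤ RCLike.re ⟪x, laplaceAofU L m φ η U τ Q a x⟫_ℂ)
    (x : BondL2K ℂ d (fineP L m) c₀ W) : γ * ‖x‖ ^ 2 ≤ RCLike.re ⟪x, A₀ x⟫_ℂ := by
  have hsub := laplaceAofU_eq_local_sub L m φ c₀ η U c₁ a' hRS hpos' τ Q a A₀ hA₀ _ rfl _ rfl
  have hA : A₀ = laplaceAofU L m φ η U τ Q a +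
      (covDerivL2K ℂ c₀ ((η : ℂ))⁻¹ (adTransportW φ U) ∘ₗ GpOfU L m φ η U a' (c₁ := c₁) hpos' ∘ₗ
        LinearMap.adjoint ((WL2.linearEquiv ℂ ℂ (fun _ : TSite d m => c₁)).symm.toLinearMap ∘ₗ QprimeW L m φ U (c₀ := c₀))) ∘ₗ
      greenK _ (QGGQ_pos L m φ c₀ η U c₁ a' hRS hpos') ∘ₗ
      (((WL2.linearEquiv ℂ ℂ (fun _ : TSite d m => c₁)).symm.toLinearMap ∘ₗ QprimeW L m φ U (c₀ := c₀)) ∘ₗ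
        GpOfU L m φ η U a' (c₁ := c₁) hpos' ∘ₗ covDivL2K ℂ c₀ ((η : ℂ))⁻¹ (adTransportW φ fun b => (U b)⁻¹)) := by
    rw [hsub]; abel
  have hcorr := re_inner_correction_nonneg L m φ c₀ η U c₁ a' hRS hpos' _ rfl _ rfl x
  rw [hA, LinearMap.add_apply, inner_add_right, map_add]
  simp only [LinearMap.comp_apply] at hcorr ⊢
  linarith [hcoer x]

include hRS hpos' in
/-- **`‖A₀⁻¹g‖ ≤ γ⁻¹‖g‖` — THE ENERGY LETTER (E₀) OF THE `A₀⁻¹` ROWS IN THM 3.11's CURRENCY** (`local_coercive_of_coercive` + `norm_greenK_le`; `hpos₀` any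
positivity witness, e.g. `local_pos_of_pos`). [cite: Balaban1985BackgroundPropagators, (3.26) p.395, Thm 3.11 p.416, Thm 3.4 p.400] -/
theorem norm_localInv_le
    (A₀ : BondL2K ℂ d (fineP L m) c₀ W →ₗ[ℂ] BondL2K ℂ d (fineP L m) c₀ W)
    (hA₀ : A₀ = hessOp φ η U τ + covDerivL2K ℂ c₀ ((η : ℂ))⁻¹ (adTransportW φ U) ∘ₗ covDivL2K ℂ c₀ ((η : ℂ))⁻¹ (adTransportW φ fun b => (U b)⁻¹) +
      LinearMap.adjoint Q ∘ₗ ((a : ℂ) • Q))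
    {γ : ℝ} (hγ : 0 < γ) (hcoer : ∀ x : BondL2K ℂ d (fineP L m) c₀ W, γ * ‖x‖ ^ 2 ≤ RCLike.re ⟪x, laplaceAofU L m φ η U τ Q a x⟫_ℂ)
    (hpos₀ : ∀ x : BondL2K ℂ d (fineP L m) c₀ W, x ≠ 0 → 0 < RCLike.re ⟪x, A₀ x⟫_ℂ) (g : BondL2K ℂ d (fineP L m) c₀ W) :
    ‖greenK A₀ hpos₀ g‖ ≤ γ⁻¹ * ‖g‖ :=
  norm_greenK_le hγ (local_coercive_of_coercive L m φ c₀ η U c₁ a' hRS hpos' τ Q a A₀ hA₀ hcoer) hpos₀ g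

end LocalEnergy
end Literature.MathematicalPhysics.QuantumFieldTheory.Balaban1983to89.B9Eq326WoodburySchur
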